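import Summits.KontsevichZagierPeriods.KontsevichZagierPeriods.Theorems.TerasomaMultiplicationMultiplicationAccessibleCornerGraphSpellingGen
import Summits.KontsevichZagierPeriods.KontsevichZagierPeriods.Theorems.TerasomaMultiplicationMultiplicationAccessibleCornerGraphDeriv

/-!
# `MultiplicationAccessible` (stmt-KontsevichZagierPeriods-12305), line `shifted-family-prime-sieve`:
the general-`p` corner Stokes graph package, II — the `v`-derivative of `V_v`

Dimension `p = n + 2`, Stokes coordinates `w = (u, v)`, `u = Fin.init w ∈ U`, `v = w (Fin.last _)`.
The `v`-component of the closed `p`-form of the corner Stokes is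
`V_v w = −(1/p)·v^(px)·(1 − vZ)^(ps−1)·H^(ps−1)·K·Σ_k M_k/t_k` (all atoms read at `u = Fin.init w`).
Only the `v`-slot moves under `a ↦ V_v(update w last a)` (`Fin.init_update_last`); by the division
spelling (`cornerGraphSpellingGen`: `G(T u)y^(n+1) = (1/p)y^(ps−1)K·ΣM/t`, `y = H(1 − Z)`) the
constant factor is `G(T u)y^(n+1)/(1 − Z)^(ps−1)`, so `−V_v` is the primitive
`v^(px)((1 − vZ)/(1 − Z))^(ps−1)·G(T u)y^(n+1)` of the general `v`-move, and `∂_v V_v` is minus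
its integrand (`cornerGraphDerivGen`, registered sub-goal; dimension-`p` version of
`cornerGraphDeriv`). References: Kontsevich–Zagier 2001 §1.2 rule (3).
-/

noncomputable section

open MeasureTheory Set Real
open scoped BigOperators

namespace Summit.KontsevichZagierPeriods.TerasomaMultiplication.MultiplicationAccessible

/-- **The `v`-derivative of `V_v`, dimension `p = n + 2`** (registered sub-goal
`cornerGraphDerivGen`): on `W`, `a ↦ V_v(update w last a) = −(1/p)H^(ps−1)K(ΣM/t)·a^(px)(1 − aZ)^(ps−1)`
(only the `v`-slot moves), and since `(1/p)H^(ps−1)K·ΣM/t = G(T u)y^(n+1)/(1 − Z)^(ps−1)`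
(division spelling, `y = H(1 − Z)`), its derivative at `v` is
`−(px·v^(px−1)ρ^(ps−1) − (ps−1)v^(px)Zρ^(ps−2)/(1 − Z))·G(T u)y^(n+1)`, `ρ = (1 − vZ)/(1 − Z)`.
[cite: KontsevichZagier2001, §1.2 rule (3)] -/
theorem cornerGraphDerivGen : ∀ (n : ℕ) (x s : ℚ), 2 ≤ x → 3 ≤ s → ∀ (Θ T : (Fin (n + 2) → ℝ) → Fin (n + 2) → ℝ) (Z S H K : (Fin (n + 2) → ℝ) → ℝ)
      (M : (Fin (n + 2) → ℝ) → Fin (n + 2) → ℝ) (P : (Fin (n + 3) → ℝ) → ℝ),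
    (∀ u, Θ u 0 = 1 - ∑ i : Fin (n + 1), u (Fin.castSucc i)) → (∀ u (i : Fin (n + 1)), Θ u i.succ = u (Fin.castSucc i)) →
    (∀ u k, T u k = 1 - u (Fin.last (n + 1)) * Θ u k) →
    (∀ u, Z u = (∏ k, T u k) ^ (1 / ((n:ℝ) + 2))) →
    (∀ u, S u = ∑ j ∈ Finset.range (n + 2), (-1:ℝ) ^ j * u (Fin.last (n + 1)) ^ j *
      ∑ A ∈ Finset.powersetCard (j + 1) (Finset.univ : Finset (Fin (n + 2))), ∏ k ∈ A, Θ u k) →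
    (∀ u, H u = (∑ j ∈ Finset.range (n + 2), Z u ^ j) / S u) →
    (∀ u, K u = (∏ k, Θ u k) ^ ((s:ℝ) - 1)) →
    (∀ u k, M u k = (T u k) ^ (x:ℝ) * ∏ j : Fin (n + 1), (T u (k + j.succ)) ^ ((x:ℝ) + (((j:ℕ):ℝ) + 1) / ((n:ℝ) + 2) - 1)) →
    (∀ w, P w = (w (Fin.last (n + 2))) ^ (((n:ℝ) + 2) * (x:ℝ) - 1) *
      (1 - w (Fin.last (n + 2)) * Z (Fin.init w)) ^ (((n:ℝ) + 2) * (s:ℝ) - 1) * H (Fin.init w) ^ (((n:ℝ) + 2) * (s:ℝ)) * K (Fin.init w)) →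
    ∀ (G : (Fin (n + 2) → ℝ) → ℝ), (∀ t : Fin (n + 2) → ℝ, G t = (∑ j : Fin (n + 2), (∏ i ∈ Finset.univ.filter (fun i : Fin (n + 2) => i < j), t i) /
        ((∏ k, t k) ^ (1 / ((n:ℝ) + 2))) ^ (j:ℕ)) / ((n:ℝ) + 2) *
      ∏ k : Fin (n + 2), (t k) ^ ((x:ℝ) + ((k:ℕ):ℝ) / ((n:ℝ) + 2) - 1) * (1 - t k) ^ ((s:ℝ) - 1)) →
    ∀ (Vv : (Fin (n + 3) → ℝ) → ℝ), (∀ w, Vv w = -(1 / ((n:ℝ) + 2) * (w (Fin.last (n + 2))) ^ (((n:ℝ) + 2) * (x:ℝ)) *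
      (1 - w (Fin.last (n + 2)) * Z (Fin.init w)) ^ (((n:ℝ) + 2) * (s:ℝ) - 1) * H (Fin.init w) ^ (((n:ℝ) + 2) * (s:ℝ) - 1) *
      K (Fin.init w) * ∑ k, M (Fin.init w) k / T (Fin.init w) k)) →
    ∀ w ∈ {w : Fin (n + 3) → ℝ | (Fin.init w : Fin (n + 2) → ℝ) ∈ {u : Fin (n + 2) → ℝ | (∀ i : Fin (n + 1), 0 < u (Fin.castSucc i)) ∧ ∑ i : Fin (n + 1), u (Fin.castSucc i) < 1 ∧ 0 < u (Fin.last (n + 1)) ∧ u (Fin.last (n + 1)) * (1 - ∑ i : Fin (n + 1), u (Fin.castSucc i)) < 1 ∧ ∀ i : Fin (n + 1), u (Fin.last (n + 1)) * u (Fin.castSucc i) < 1} ∧ 0 < w (Fin.last (n + 2)) ∧ w (Fin.last (n + 2)) < 1},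
      HasDerivAt (fun a => Vv (Function.update w (Fin.last (n + 2)) a))
        (-((((n:ℝ) + 2) * (x:ℝ) * (w (Fin.last (n + 2))) ^ (((n:ℝ) + 2) * (x:ℝ) - 1) *
            ((1 - w (Fin.last (n + 2)) * Z (Fin.init w)) / (1 - Z (Fin.init w))) ^ (((n:ℝ) + 2) * (s:ℝ) - 1) -
          (((n:ℝ) + 2) * (s:ℝ) - 1) * (w (Fin.last (n + 2))) ^ (((n:ℝ) + 2) * (x:ℝ)) * Z (Fin.init w) *
            ((1 - w (Fin.last (n + 2)) * Z (Fin.init w)) / (1 - Z (Fin.init w))) ^ (((n:ℝ) + 2) * (s:ℝ) - 2) / (1 - Z (Fin.init w))) *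
          (G (T (Fin.init w)) * ((Fin.init w : Fin (n + 2) → ℝ) (Fin.last (n + 1))) ^ (n + 1)))) (w (Fin.last (n + 2))) := by
  intro n x s hx hs Θ T Z S H K M P hΘ0 hΘs hT hZ hS hH hK hM hP G hG Vv hVv w hw
  obtain ⟨hu, hv0, hv1⟩ := hw
  obtain ⟨hGD, -, hHy⟩ :=
    cornerGraphSpellingGen n x s hx hs Θ T Z S H K M P hΘ0 hΘs hT hZ hS hH hK hM hP G hG _ hu
  obtain ⟨-, ⟨hz0, hz1⟩, -, -⟩ := CornerGraphGen.S_pos_H hΘ0 hΘs hT hZ hS hH hu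
  have hy : 0 < (Fin.init w : Fin (n + 2) → ℝ) (Fin.last (n + 1)) := hu.2.2.1
  have h1z : 0 < 1 - Z (Fin.init w) := by linarith
  have hvz : 0 < 1 - w (Fin.last (n + 2)) * Z (Fin.init w) := by nlinarith
  have hHpos : 0 < H (Fin.init w) := pos_of_mul_pos_left (by rw [hHy]; exact hy) h1z.le
  -- `y^(ps-1) = H^(ps-1) (1 - Z)^(ps-1)`
  have hyP : ((Fin.init w : Fin (n + 2) → ℝ) (Fin.last (n + 1))) ^ (((n:ℝ) + 2) * (s:ℝ) - 1) =
      H (Fin.init w) ^ (((n:ℝ) + 2) * (s:ℝ) - 1) *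
        (1 - Z (Fin.init w)) ^ (((n:ℝ) + 2) * (s:ℝ) - 1) := by
    rw [← mul_rpow hHpos.le h1z.le, hHy]
  -- only the `v`-slot moves
  have hfun : (fun a => Vv (Function.update w (Fin.last (n + 2)) a)) = fun a =>
      -(1 / ((n:ℝ) + 2) * a ^ (((n:ℝ) + 2) * (x:ℝ)) *
        (1 - a * Z (Fin.init w)) ^ (((n:ℝ) + 2) * (s:ℝ) - 1) *
        H (Fin.init w) ^ (((n:ℝ) + 2) * (s:ℝ) - 1) * K (Fin.init w) *
        ∑ k, M (Fin.init w) k / T (Fin.init w) k) := by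
    funext a
    rw [hVv, Fin.init_update_last, Function.update_self]
  rw [hfun, hGD, hyP]
  -- atoms
  set v := w (Fin.last (n + 2))
  set z := Z (Fin.init w)
  set Hp := H (Fin.init w) ^ (((n:ℝ) + 2) * (s:ℝ) - 1)
  set Kw := K (Fin.init w)
  set Sg := ∑ k, M (Fin.init w) k / T (Fin.init w) k
  -- the one-variable derivative of `a ↦ -(1/p a^(px) (1 - a z)^(ps-1) Hp Kw Sg)`
  have d1 : HasDerivAt (fun a : ℝ => a ^ (((n:ℝ) + 2) * (x:ℝ)))
      (((n:ℝ) + 2) * (x:ℝ) * v ^ (((n:ℝ) + 2) * (x:ℝ) - 1)) v := by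
    simpa using (hasDerivAt_id v).rpow_const (p := ((n:ℝ) + 2) * (x:ℝ)) (Or.inl hv0.ne')
  have d2 : HasDerivAt (fun a : ℝ => (1 - a * z) ^ (((n:ℝ) + 2) * (s:ℝ) - 1))
      (-(1 * z) * (((n:ℝ) + 2) * (s:ℝ) - 1) *
        (1 - v * z) ^ (((n:ℝ) + 2) * (s:ℝ) - 1 - 1)) v :=
    (((hasDerivAt_id v).mul_const z).const_sub 1).rpow_const (Or.inl hvz.ne')
  have d := (((((d1.const_mul (1 / ((n:ℝ) + 2))).mul d2).mul_const Hp).mul_const Kw).mul_const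
    Sg).neg
  refine d.congr_deriv ?_
  -- the identity of the two spellings of the derivative
  rw [show ((n:ℝ) + 2) * (s:ℝ) - 1 - 1 = ((n:ℝ) + 2) * (s:ℝ) - 2 by ring,
    div_rpow hvz.le h1z.le (((n:ℝ) + 2) * (s:ℝ) - 1),
    div_rpow hvz.le h1z.le (((n:ℝ) + 2) * (s:ℝ) - 2),
    CornerGraph.rpow_eq_rpow_sub_one_mul hvz.ne' (((n:ℝ) + 2) * (s:ℝ) - 1),
    CornerGraph.rpow_eq_rpow_sub_one_mul h1z.ne' (((n:ℝ) + 2) * (s:ℝ) - 1),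
    CornerGraph.rpow_eq_rpow_sub_one_mul hv0.ne' (((n:ℝ) + 2) * (x:ℝ)),
    show ((n:ℝ) + 2) * (s:ℝ) - 1 - 1 = ((n:ℝ) + 2) * (s:ℝ) - 2 by ring]
  set p1 := v ^ (((n:ℝ) + 2) * (x:ℝ) - 1)
  set p2 := (1 - v * z) ^ (((n:ℝ) + 2) * (s:ℝ) - 2)
  set p3 := (1 - z) ^ (((n:ℝ) + 2) * (s:ℝ) - 2)
  set omz := 1 - z
  have homz0 : omz ≠ 0 := h1z.ne'
  have hp30 : p3 ≠ 0 := (rpow_pos_of_pos h1z _).ne'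
  have hP0 : (n:ℝ) + 2 ≠ 0 := by positivity
  field_simp
  ring

end Summit.KontsevichZagierPeriods.TerasomaMultiplication.MultiplicationAccessible

end
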